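import Literature.AlgebraicGeometry.ShimuraVarieties.UnitaryBallLevelFiniteCover
import Literature.NumberTheory.Transcendental.AnalytificationLocalBiholomorphism
import Literature.NumberTheory.Transcendental.AnalytificationCoordinateHolomorphyTransport
import HarnessLib

/-!
# The ball uniformisation of a torsion-free ball quotient is a local biholomorphism into ANY
# analytification (also through an open immersion `X₂ ↪ X`)

Topic `Literature/AlgebraicGeometry/ShimuraVarieties`, namespace
`Literature.AlgebraicGeometry.ShimuraVarieties` (grouping sub-namespace
`UnitaryBallUniformisationDatum`). THEOREMS ONLY.

For `D₂ : UnitaryBallUniformisationDatum 2 X₂` (★ `UnitaryBallQuotientDatum.lean`: `X₂(ℂ) = Γ\𝔹²`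
as a set, `unif` continuous, open, onto, holomorphic in algebraic coordinates, `Γ` torsion free) and a
Sylvester frame `𝔣` (`𝔣.tᴴ H^{τ₁} 𝔣.t = J`), the uniformisation read on the affine ball
`𝔹² = {w ∈ ℂ² : |w|² < 1}`, `w ↦ unif (𝔣.t (w₀, w₁, 1))` (= ★ `ballUnifMap 𝔣` on `𝔹²`), is a local
homeomorphism (★ `isLocalHomeomorph_ballUnifMap`).  The tree's ★ `UnitaryBallLocalBiholomorphy`
proves that it is a local biholomorphism into the HODGE MODEL `X₂^an` (`HodgeModel 2 X₂`); here the
same is recorded for an ARBITRARY analytification `ψ : M → X(ℂ)` (`IsAnalytification E X m ψ`) of a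
smooth `X` receiving `X₂` by an open immersion `j : X₂ ⟶ X` — the shape in which a PIECE of a
coproduct `X = ∐ X_q` of ball quotients is uniformised (generic engine:
`IsAnalytification.bijective_mfderiv_symm_comp`, Clements–Osgood + Brouwer):

* `differentiableOn_unif_frameLift` — `w ↦ unif (𝔣.t (w₀, w₁, 1))` is holomorphic in algebraic
  coordinates on `𝔹²`;
* `isLocalHomeomorph_restrict_unif_frameLift` — restricted to `𝔹²` it is a local homeomorphism;
* `mdifferentiableAt_lift_map_unif_frameLift`, `bijective_mfderiv_lift_map_unif_frameLift` — for
  `j : X₂ ⟶ X` an open immersion and `ψ` an analytification of `X` with holomorphic atlas, the lift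
  `ψ⁻¹ ∘ j(ℂ) ∘ unif ∘ 𝔣.t(·, 1)` is holomorphic on `𝔹²` with bijective differential;
* `eq_two_of_isAnalytification` — such an `X` has dimension `m = 2`.

## References

* [BergeronMillsonMoeglin2016Balls] N. Bergeron, J. Millson, C. Moeglin, Acta Math. 216 (2016),
  Introduction §1.1 (`S(Γ) = Γ\𝔹` is a complex manifold for torsion-free `Γ`).
* [FritzscheGrauert2002] K. Fritzsche, H. Grauert, *From Holomorphic Functions to Complex
  Manifolds*, Ch. I §8 Thm. 8.5, Ch. IV §1.
-/

noncomputable section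

open Set Function Filter TopologicalSpace CategoryTheory AlgebraicGeometry Matrix
open scoped Manifold ContDiff Topology

namespace Literature.AlgebraicGeometry.ShimuraVarieties

open Literature.AlgebraicGeometry.Motives (ComplexPoints AlgPoints SchemeOver)
open Literature.AlgebraicGeometry.Motives.AlgPoints
open Literature.Geometry.ComplexHyperbolic Literature.Geometry.ComplexHyperbolic.BallModel
open Literature.NumberTheory.Transcendental

namespace UnitaryBallUniformisationDatum

variable {X₂ : SchemeOver ℂ} (D₂ : UnitaryBallUniformisationDatum 2 X₂) (𝔣 : D₂.SylvesterFrame)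

/-! ### §1. The uniformisation on the affine ball `𝔹² ⊆ ℂ²` -/

/-- The affine section `w ↦ 𝔣.t (w₀, w₁, 1)` of the frame over `ℂ²` is complex-differentiable
(private twin of ★ `differentiable_frameLift` of `UnitaryBallFormPullback`, not imported here).
[cite: BergeronMillsonMoeglin2016Balls, Introduction §1.1] -/
private theorem differentiable_frameLift_aux :
    Differentiable ℂ fun w : Fin 2 → ℂ ↦ 𝔣.t *ᵥ ![w 0, w 1, 1] := by
  have h1 : Differentiable ℂ fun w : Fin 2 → ℂ ↦ (![w 0, w 1, 1] : Fin 3 → ℂ) := by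
    refine differentiable_pi.2 fun i ↦ ?_
    fin_cases i
    · exact differentiable_apply (𝕜 := ℂ) (0 : Fin 2)
    · exact differentiable_apply (𝕜 := ℂ) (1 : Fin 2)
    · exact differentiable_const (1 : ℂ)
  exact (LinearMap.toContinuousLinearMap (Matrix.mulVecLin 𝔣.t)).differentiable.comp h1

/-- On the ball, `𝔣.t (w₀, w₁, 1)` is a cone vector. [cite: BergeronMillsonMoeglin2016Balls, Introduction §1.1] -/
theorem frameLift_mem_cone {w : Fin 2 → ℂ} (hw : w ∈ BallForms.ballSet) :
    𝔣.t *ᵥ ![w 0, w 1, 1] ∈ D₂.cone :=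
  (D₂.coneLift 𝔣 ⟨w, hw⟩).2

/-- The uniformisation on `ℂ²` restricted to the ball IS ★ `ballUnifMap 𝔣`.
[cite: BergeronMillsonMoeglin2016Balls, Introduction §1.1] -/
theorem restrict_unif_frameLift_eq :
    BallForms.ballSet.restrict (fun w : Fin 2 → ℂ ↦ D₂.unif (𝔣.t *ᵥ ![w 0, w 1, 1])) =
      D₂.ballUnifMap 𝔣 := by
  funext z
  rfl

/-- **`𝔹² → X₂(ℂ)` is a local homeomorphism** (★ `isLocalHomeomorph_ballUnifMap`, on `ℂ²`).
[cite: BergeronMillsonMoeglin2016Balls, Introduction §1.1] -/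
theorem isLocalHomeomorph_restrict_unif_frameLift :
    IsLocalHomeomorph
      (BallForms.ballSet.restrict (fun w : Fin 2 → ℂ ↦ D₂.unif (𝔣.t *ᵥ ![w 0, w 1, 1]))) := by
  rw [restrict_unif_frameLift_eq]
  exact D₂.isLocalHomeomorph_ballUnifMap 𝔣

/-- The uniformisation on `ℂ²` is continuous on the ball. [cite: BergeronMillsonMoeglin2016Balls, Introduction §1.1] -/
theorem continuousOn_unif_frameLift :
    ContinuousOn (fun w : Fin 2 → ℂ ↦ D₂.unif (𝔣.t *ᵥ ![w 0, w 1, 1])) BallForms.ballSet := by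
  rw [continuousOn_iff_continuous_restrict, restrict_unif_frameLift_eq]
  exact D₂.continuous_ballUnifMap 𝔣

/-- **The ball uniformisation is holomorphic in algebraic coordinates**: every regular function on
an affine open `U ⊆ X₂`, read through `w ↦ unif (𝔣.t (w₀, w₁, 1))`, is holomorphic on the part of
the ball above `U` (field `differentiableOn_unif` on the cone, composed with the affine section).
[cite: BergeronMillsonMoeglin2016Balls, Introduction §1.1] -/
theorem differentiableOn_unif_frameLift (U : X₂.left.affineOpens)
    (s : X₂.left.presheaf.obj (Opposite.op (↑U : X₂.left.Opens))) :
    DifferentiableOn ℂ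
      (fun w : Fin 2 → ℂ ↦ evalOrZero (↑U : X₂.left.Opens) s (D₂.unif (𝔣.t *ᵥ ![w 0, w 1, 1])))
      (BallForms.ballSet ∩
        (fun w : Fin 2 → ℂ ↦ D₂.unif (𝔣.t *ᵥ ![w 0, w 1, 1])) ⁻¹'
          {P | P.pt ∈ (↑U : X₂.left.Opens)}) := by
  have hmaps : MapsTo (fun w : Fin 2 → ℂ ↦ 𝔣.t *ᵥ ![w 0, w 1, 1])
      (BallForms.ballSet ∩
        (fun w : Fin 2 → ℂ ↦ D₂.unif (𝔣.t *ᵥ ![w 0, w 1, 1])) ⁻¹' {P | P.pt ∈ (↑U : X₂.left.Opens)})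
      (D₂.cone ∩ D₂.unif ⁻¹' {P | P.pt ∈ (↑U : X₂.left.Opens)}) :=
    fun w hw ↦ ⟨D₂.frameLift_mem_cone 𝔣 hw.1, hw.2⟩
  exact (D₂.differentiableOn_unif U s).comp (differentiable_frameLift_aux D₂ 𝔣).differentiableOn hmaps

/-! ### §2. Through an open immersion `j : X₂ ⟶ X`, into any analytification of `X` -/

section Analytification

variable {X : SchemeOver ℂ} {E : Type*} [NormedAddCommGroup E] [NormedSpace ℂ E]
  [FiniteDimensional ℂ E] {M : Type*} [TopologicalSpace M] [ChartedSpace E M] {m : ℕ}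
  {ψ : M → ComplexPoints X}

/-- `j(ℂ) ∘ unif ∘ 𝔣.t(·,1)` restricted to the ball is a local homeomorphism into `X(ℂ)` for an open
immersion `j : X₂ ⟶ X`. [cite: BergeronMillsonMoeglin2016Balls, Introduction §1.1] -/
theorem isLocalHomeomorph_restrict_map_unif_frameLift (j : X₂ ⟶ X) [IsOpenImmersion j.left] :
    IsLocalHomeomorph (BallForms.ballSet.restrict
      (AlgPoints.map j ∘ fun w : Fin 2 → ℂ ↦ D₂.unif (𝔣.t *ᵥ ![w 0, w 1, 1]))) :=
  isLocalHomeomorph_restrict_map_comp (D₂.isLocalHomeomorph_restrict_unif_frameLift 𝔣) j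

/-- `j(ℂ) ∘ unif ∘ 𝔣.t(·,1)` is holomorphic in the algebraic coordinates of `X`, for every morphism
`j : X₂ ⟶ X`. [cite: BergeronMillsonMoeglin2016Balls, Introduction §1.1] -/
theorem differentiableOn_map_unif_frameLift (j : X₂ ⟶ X) (U : X.left.affineOpens)
    (s : X.left.presheaf.obj (Opposite.op (↑U : X.left.Opens))) :
    DifferentiableOn ℂ
      (fun w : Fin 2 → ℂ ↦ evalOrZero (↑U : X.left.Opens) s
        ((AlgPoints.map j ∘ fun w : Fin 2 → ℂ ↦ D₂.unif (𝔣.t *ᵥ ![w 0, w 1, 1])) w))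
      (BallForms.ballSet ∩
        (AlgPoints.map j ∘ fun w : Fin 2 → ℂ ↦ D₂.unif (𝔣.t *ᵥ ![w 0, w 1, 1])) ⁻¹'
          {P | P.pt ∈ (↑U : X.left.Opens)}) :=
  differentiableOn_evalOrZero_map_comp BallForms.isOpen_ballSet (D₂.continuousOn_unif_frameLift 𝔣)
    (D₂.differentiableOn_unif_frameLift 𝔣) j U s

include D₂ 𝔣 in
/-- **A smooth `X` receiving the ball quotient `X₂` by an open immersion has dimension `2`**: any
analytification of `X` has model dimension `m = 2` (invariance of dimension through the local
homeomorphism `𝔹² → X(ℂ)`). [cite: BergeronMillsonMoeglin2016Balls, Introduction §1.1] -/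
theorem eq_two_of_isAnalytification (j : X₂ ⟶ X) [IsOpenImmersion j.left]
    (hψ : IsAnalytification E X m ψ) : m = 2 := by
  have hne : BallForms.ballSet.Nonempty := ⟨x₀.1, BallForms.coe_mem_ballSet x₀⟩
  have h := hψ.finrank_eq_of_isLocalHomeomorph_restrict BallForms.isOpen_ballSet hne
    (D₂.isLocalHomeomorph_restrict_map_unif_frameLift 𝔣 j)
  rw [← h]
  simp

/-- **The lift `ψ⁻¹ ∘ j(ℂ) ∘ unif ∘ 𝔣.t(·,1) : 𝔹² → M` is holomorphic** for every analytification
`ψ : M → X(ℂ)` with holomorphic atlas of the smooth `X` and every open immersion `j : X₂ ⟶ X`.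
[cite: BergeronMillsonMoeglin2016Balls, Introduction §1.1] -/
theorem mdifferentiableAt_lift_map_unif_frameLift [SmoothOfRelativeDimension m X.hom]
    [IsManifold 𝓘(ℂ, E) ω M] (j : X₂ ⟶ X) [IsOpenImmersion j.left]
    (hψ : IsAnalytification E X m ψ) {w : Fin 2 → ℂ} (hw : w ∈ BallForms.ballSet) :
    MDifferentiableAt 𝓘(ℂ, Fin 2 → ℂ) 𝓘(ℂ, E)
      (hψ.homeomorph.symm ∘
        (AlgPoints.map j ∘ fun w : Fin 2 → ℂ ↦ D₂.unif (𝔣.t *ᵥ ![w 0, w 1, 1]))) w :=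
  hψ.mdifferentiableAt_symm_comp_of_isLocalHomeomorph BallForms.isOpen_ballSet
    (D₂.isLocalHomeomorph_restrict_map_unif_frameLift 𝔣 j) (D₂.differentiableOn_map_unif_frameLift 𝔣 j)
    hw

/-- **The ball uniformisation is a local biholomorphism into any analytification**: the
differential of the lift `ψ⁻¹ ∘ j(ℂ) ∘ unif ∘ 𝔣.t(·,1)` is bijective at every point of `𝔹²`
(Clements–Osgood in a chart of `M`). [cite: FritzscheGrauert2002, Ch. I §8 Thm. 8.5]
[cite: BergeronMillsonMoeglin2016Balls, Introduction §1.1] -/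
theorem bijective_mfderiv_lift_map_unif_frameLift [SmoothOfRelativeDimension m X.hom]
    [IsManifold 𝓘(ℂ, E) ω M] (j : X₂ ⟶ X) [IsOpenImmersion j.left]
    (hψ : IsAnalytification E X m ψ) {w : Fin 2 → ℂ} (hw : w ∈ BallForms.ballSet) :
    Function.Bijective (mfderiv 𝓘(ℂ, Fin 2 → ℂ) 𝓘(ℂ, E)
      (hψ.homeomorph.symm ∘
        (AlgPoints.map j ∘ fun w : Fin 2 → ℂ ↦ D₂.unif (𝔣.t *ᵥ ![w 0, w 1, 1]))) w) :=
  hψ.bijective_mfderiv_symm_comp BallForms.isOpen_ballSet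
    (D₂.isLocalHomeomorph_restrict_map_unif_frameLift 𝔣 j) (D₂.differentiableOn_map_unif_frameLift 𝔣 j)
    hw

/-- Surjectivity half of `bijective_mfderiv_lift_map_unif_frameLift` (the form the immersion
criterion `injective_mfderiv_of_eventuallyEq_comp` consumes). [cite: FritzscheGrauert2002, Ch. I §8 Thm. 8.5] -/
theorem surjective_mfderiv_lift_map_unif_frameLift [SmoothOfRelativeDimension m X.hom]
    [IsManifold 𝓘(ℂ, E) ω M] (j : X₂ ⟶ X) [IsOpenImmersion j.left]
    (hψ : IsAnalytification E X m ψ) {w : Fin 2 → ℂ} (hw : w ∈ BallForms.ballSet) :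
    Function.Surjective (mfderiv 𝓘(ℂ, Fin 2 → ℂ) 𝓘(ℂ, E)
      (hψ.homeomorph.symm ∘
        (AlgPoints.map j ∘ fun w : Fin 2 → ℂ ↦ D₂.unif (𝔣.t *ᵥ ![w 0, w 1, 1]))) w) :=
  (D₂.bijective_mfderiv_lift_map_unif_frameLift 𝔣 j hψ hw).2

end Analytification

end UnitaryBallUniformisationDatum

end Literature.AlgebraicGeometry.ShimuraVarieties
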